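import Summits.BirchSwinnertonDyer.BirchSwinnertonDyer.Theorems.TwoAdicConverseFullTwoTorsionNeitherPartner
import HarnessLib

/-!
# Route `TwoAdicConverse` (rung S3), items 19218 / 19219, stratum (β): full rational `2`-torsion at a good-ordinary
# OR MULTIPLICATIVE `2` — a ramified point by VIETA (`4(x₁+x₂+x₃) = −b₂` odd), hence a «neither» point, hence a
# partner in Prop-5.13 configuration

Cell `bsd-2adic`, seat `bsd-2adic-conv-1` (GEN 19).  THEOREMS ONLY; `--supports stmt-BirchSwinnertonDyer-19218`.
HONEST FRAMING: structure theorems about Greenberg's configurations (LNM 1716 §5); `μ`-statements stay PRINT facts BY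
NAME; BSD is not proved by any of this.  PARTITION (D-0054): none — RANK axis (S3) × (β) at good-ordinary AND
multiplicative `2` (conv-2's 19219 analogue; census: 24/24 multiplicative full-`2`-torsion classes show a 5.13 point).

conv-1 GEN 5 proved «one of the three rational `2`-torsion points is ramified at `2`» at a GOOD `2` from `2 ∤ Δ_min`
(`exists_twoTorsionRamifiedAtTwo_of_fullTwoTorsion`).  Here a shorter argument covers the multiplicative case too:
on the minimal equation `a₁` is odd, so `b₂` is odd, and Vieta `4(x₁ + x₂ + x₃) = −b₂` gives `v₂(x₁ + x₂ + x₃) = −2`,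
so some `xᵢ` has `v₂(xᵢ) < 0` (ultrametric inequality).

* §1 `exists_padicValRat_neg_of_sum` (ultrametric bookkeeping) and
  **`exists_twoTorsionRamifiedAtTwo_of_fullTwoTorsion_of_odd_a₁`** (good ordinary or multiplicative `2`).
* §2 **`exists_neither_of_fullTwoTorsion_of_goodOrd_or_mult`** — a «neither» point exists (GEN 5's uniqueness of the
  ramified / odd point needs no reduction hypothesis).
* §3 `exists_partner_ramified_and_odd_of_fullTwoTorsion_of_goodOrd_or_mult` — a `ℤ/2`-partner whose dual-kernel point
  is ramified AND odd, PROVIDED the partner's minimal equation is again good-ordinary or multiplicative at `2`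
  (isogenous curves have the same reduction type — Silverman VII.7.2 / Tate; the multiplicative half of that is not yet a
  tree theorem, so it is displayed as the hypothesis `hW'`; at a good ordinary `2` it is discharged by
  `goodOrd_two_iff_of_twoTorsionPair`, see `TwoAdicConverseFullTwoTorsionNeitherPartner`).

References: Greenberg LNM 1716 §5 Props. 5.13–5.14 [GreenbergLNM1716]; Silverman *AEC* III.2.3, VII.7.2 [SilvermanAEC2009].
-/

set_option linter.dupNamespace false  -- `BirchSwinnertonDyer.BirchSwinnertonDyer` is the sub's path (D-0017)
set_option autoImplicit false

noncomputable section

open scoped Classical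
open WeierstrassCurve Literature Literature.NumberTheory.EllipticCurves
  Literature.NumberTheory.EllipticCurves.Rank1Residual
  Literature.NumberTheory.EllipticCurves.Greenberg1999
  Summit.BirchSwinnertonDyer.BirchSwinnertonDyer.Theorems.TwoAdicTwistConverse

namespace Summit.BirchSwinnertonDyer.BirchSwinnertonDyer.Theorems.TwoAdicOffHabitat

/-! ## §1 Vieta forces a ramified point whenever `a₁` is odd -/

/-- Ultrametric bookkeeping: if `v₂(x₁ + x₂ + x₃) < 0` then some `v₂(xᵢ) < 0`. [folklore] -/
theorem exists_padicValRat_neg_of_sum {x₁ x₂ x₃ : ℚ} (h0 : x₁ + x₂ + x₃ ≠ 0)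
    (hv : padicValRat 2 (x₁ + x₂ + x₃) < 0) :
    padicValRat 2 x₁ < 0 ∨ padicValRat 2 x₂ < 0 ∨ padicValRat 2 x₃ < 0 := by
  haveI : Fact (Nat.Prime 2) := ⟨Nat.prime_two⟩
  by_contra hcon
  push Not at hcon
  obtain ⟨h₁, h₂, h₃⟩ := hcon
  have h12 : 0 ≤ padicValRat 2 (x₁ + x₂) := by
    by_cases h120 : x₁ + x₂ = 0
    · rw [h120]; simp
    · rcases le_total (padicValRat 2 x₁) (padicValRat 2 x₂) with h | h
      · exact h₁.trans (padicValRat.le_padicValRat_add_of_le h120 h)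
      · rw [add_comm] at h120 ⊢
        exact h₂.trans (padicValRat.le_padicValRat_add_of_le h120 h)
  have h123 : 0 ≤ padicValRat 2 (x₁ + x₂ + x₃) := by
    rcases le_total (padicValRat 2 (x₁ + x₂)) (padicValRat 2 x₃) with h | h
    · exact h12.trans (padicValRat.le_padicValRat_add_of_le h0 h)
    · have h0' : x₃ + (x₁ + x₂) ≠ 0 := by rwa [add_comm]
      have := h₃.trans (padicValRat.le_padicValRat_add_of_le h0' h)
      rwa [add_comm] at this
  exact absurd hv (not_lt.mpr h123)

variable (W : WeierstrassCurve ℚ) [W.IsElliptic] [W.IsGloballyMinimal]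

omit [W.IsElliptic] in
/-- **`a₁` odd (good ordinary or multiplicative at `2`) and three rational points of order `2` of distinct abscissae
⟹ one of them is ramified at `2`**: `4(x₁ + x₂ + x₃) = −b₂` with `b₂` odd has `v₂ = −2`.
[cite: GreenbergLNM1716, §5 p. 170 (C₂[2] ≠ 0)] [cite: SilvermanAEC2009, III.2.3 (ψ₂)] -/
theorem exists_twoTorsionRamifiedAtTwo_of_fullTwoTorsion_of_odd_a₁ (ha₁ : Odd (integralModelInt W).a₁)
    {x₁ x₂ x₃ : ℚ} (h12 : x₁ ≠ x₂) (h13 : x₁ ≠ x₃) (h23 : x₂ ≠ x₃) (h₁ : HasRationalTwoTorsionX W x₁)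
    (h₂ : HasRationalTwoTorsionX W x₂) (h₃ : HasRationalTwoTorsionX W x₃) :
    TwoTorsionRamifiedAtTwo x₁ ∨ TwoTorsionRamifiedAtTwo x₂ ∨ TwoTorsionRamifiedAtTwo x₃ := by
  haveI : Fact (Nat.Prime 2) := ⟨Nat.prime_two⟩
  obtain ⟨y₁, hP₁, ht₁⟩ := h₁
  obtain ⟨y₂, hP₂, ht₂⟩ := h₂
  obtain ⟨y₃, hP₃, ht₃⟩ := h₃
  have c₁ := fourXCubed_add_eq_zero_of_twoTorsion hP₁ ht₁
  have c₂ := fourXCubed_add_eq_zero_of_twoTorsion hP₂ ht₂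
  have c₃ := fourXCubed_add_eq_zero_of_twoTorsion hP₃ ht₃
  obtain ⟨hS, -, -⟩ := vieta_of_three_twoTorsion_roots c₁ c₂ c₃ h12 h13 h23
  obtain ⟨hb₂, -, -⟩ := b₂_b₄_b₆_eq_intCast W
  have hB₂ : Odd (integralModelInt W).b₂ := odd_b₂_integralModelInt_of_odd_a₁ W ha₁
  set B₂ : ℤ := (integralModelInt W).b₂ with hB₂def
  have hsum : x₁ + x₂ + x₃ = -(B₂ : ℚ) / 4 := by rw [hb₂] at hS; linear_combination hS / 4
  have hB₂0 : (B₂ : ℚ) ≠ 0 := by exact_mod_cast fun h0 ↦ (Int.not_even_iff_odd.mpr hB₂) (by simp [h0])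
  have h0 : x₁ + x₂ + x₃ ≠ 0 := by rw [hsum]; exact div_ne_zero (neg_ne_zero.mpr hB₂0) four_ne_zero
  have hv : padicValRat 2 (x₁ + x₂ + x₃) < 0 := by
    rw [hsum, neg_div, padicValRat.neg, padicValRat.div hB₂0 four_ne_zero, padicValRat.of_int,
      padicValInt.eq_zero_of_not_dvd (by simpa [even_iff_two_dvd] using Int.not_even_iff_odd.mpr hB₂),
      show (4 : ℚ) = ((2 : ℕ) : ℚ) ^ 2 by norm_num, padicValRat.pow, padicValRat.self one_lt_two]
    norm_num
  exact exists_padicValRat_neg_of_sum h0 hv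

/-! ## §2 A «neither» point at a good-ordinary or multiplicative `2` -/

/-- **Good ordinary or multiplicative at `2`, full rational `2`-torsion ⟹ a «neither» point** (the abscissa other
than the unique ramified one and the unique odd one). [cite: GreenbergLNM1716, §5 Props. 5.13–5.14 (pp. 120–121)] -/
theorem exists_neither_of_fullTwoTorsion_of_goodOrd_or_mult (hW : GoodOrd W 2 ∨ Mult W 2) {x₁ x₂ x₃ : ℚ}
    (h12 : x₁ ≠ x₂) (h13 : x₁ ≠ x₃) (h23 : x₂ ≠ x₃) (h₁ : HasRationalTwoTorsionX W x₁)
    (h₂ : HasRationalTwoTorsionX W x₂) (h₃ : HasRationalTwoTorsionX W x₃) :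
    ∃ b : ℚ, HasRationalTwoTorsionX W b ∧ ¬ TwoTorsionRamifiedAtTwo b ∧ ¬ TwoTorsionOdd W b := by
  have ha₁ := odd_a₁_integralModelInt_of_goodOrd_or_mult W hW
  obtain ⟨a, ha, hRa⟩ : ∃ a, HasRationalTwoTorsionX W a ∧ TwoTorsionRamifiedAtTwo a := by
    rcases exists_twoTorsionRamifiedAtTwo_of_fullTwoTorsion_of_odd_a₁ W ha₁ h12 h13 h23 h₁ h₂ h₃ with h | h | h
    exacts [⟨x₁, h₁, h⟩, ⟨x₂, h₂, h⟩, ⟨x₃, h₃, h⟩]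
  obtain ⟨c, hc, hOc⟩ : ∃ c, HasRationalTwoTorsionX W c ∧ TwoTorsionOdd W c := by
    rcases twoTorsionOdd_or_of_fullTwoTorsion W h12 h13 h23 h₁ h₂ h₃ with h | h | h
    exacts [⟨x₁, h₁, h⟩, ⟨x₂, h₂, h⟩, ⟨x₃, h₃, h⟩]
  obtain ⟨b, hb, hba, hbc⟩ := exists_third_of_three h12 h13 h23
    (eq_or_eq_or_eq_of_hasRationalTwoTorsionX W h12 h13 h23 h₁ h₂ h₃ ha)
    (eq_or_eq_or_eq_of_hasRationalTwoTorsionX W h12 h13 h23 h₁ h₂ h₃ hc)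
  have hbX : HasRationalTwoTorsionX W b := by
    rcases hb with rfl | rfl | rfl
    exacts [h₁, h₂, h₃]
  refine ⟨b, hbX, fun hRb ↦ hba ?_, fun hOb ↦ hbc ?_⟩
  · exact eq_of_twoTorsionRamifiedAtTwo_of_fullTwoTorsion W h12 h13 h23 h₁ h₂ h₃ hbX hRb ha hRa
  · exact twoTorsionOdd_unique W hbX hc hOb hOc

/-! ## §3 The partner in Prop-5.13 configuration (reduction type of the partner displayed) -/

/-- **Good ordinary or multiplicative at `2`, full rational `2`-torsion ⟹ a `ℤ/2`-partner whose dual-kernel point is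
ramified AND odd, provided the partner's minimal equation is again good-ordinary or multiplicative at `2`** (`hW'`:
the multiplicative half of "isogenous curves have the same reduction type" is displayed, not proved here).
[cite: GreenbergLNM1716, §5 Props. 5.13–5.14 (pp. 120–121)] [cite: SilvermanAEC2009, Cor. VII.7.2] -/
theorem exists_partner_ramified_and_odd_of_fullTwoTorsion_of_goodOrd_or_mult (hW : GoodOrd W 2 ∨ Mult W 2)
    (hW' : ∀ (W' : WeierstrassCurve ℚ) [W'.IsElliptic] [W'.IsGloballyMinimal], IsIsogenous W W' →
      GoodOrd W' 2 ∨ Mult W' 2)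
    {x₁ x₂ x₃ : ℚ} (h12 : x₁ ≠ x₂) (h13 : x₁ ≠ x₃) (h23 : x₂ ≠ x₃) (h₁ : HasRationalTwoTorsionX W x₁)
    (h₂ : HasRationalTwoTorsionX W x₂) (h₃ : HasRationalTwoTorsionX W x₃) :
    ∃ (C : VariableChange ℚ) (_ : (C • W).IsTwoTorsionNF) (W' : WeierstrassCurve ℚ) (_ : W'.IsElliptic)
      (_ : W'.IsGloballyMinimal) (C' : VariableChange ℚ),
      C' • W' = (C • W).twoIsogenyCodomain ∧ (GoodOrd W' 2 ∨ Mult W' 2) ∧ (W.HasCM ↔ W'.HasCM) ∧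
      HasRationalTwoTorsionX W' C'.r ∧ TwoTorsionRamifiedAtTwo C'.r ∧ TwoTorsionOdd W' C'.r := by
  obtain ⟨b, ⟨y, hEq, h2⟩, hNR, hNO⟩ := exists_neither_of_fullTwoTorsion_of_goodOrd_or_mult W hW h12 h13 h23 h₁ h₂ h₃
  set C : VariableChange ℚ := ⟨1, b, -W.a₁ / 2, y⟩ with hC
  have hns : W.toAffine.Nonsingular b y := (WeierstrassCurve.Affine.equation_iff_nonsingular).mp hEq
  have hy : y = W.toAffine.negY b y := by
    rw [WeierstrassCurve.Affine.negY]; linear_combination h2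
  haveI hNF : (C • W).IsTwoTorsionNF := isTwoTorsionNF_smul_of_two_nsmul_eq_zero two_ne_zero hns hy
  obtain ⟨C₀, hmin⟩ := hasGlobalMinimalModel_rat_holds (C • W).twoIsogenyCodomain
  set W' : WeierstrassCurve ℚ := C₀ • (C • W).twoIsogenyCodomain with hW'def
  haveI : W'.IsGloballyMinimal := hmin
  have hlink : C₀⁻¹ • W' = (C • W).twoIsogenyCodomain := inv_smul_smul C₀ _
  haveI : (C₀⁻¹ • W').IsTwoTorsionNF := by rw [hlink]; infer_instance
  have hred' : GoodOrd W' 2 ∨ Mult W' 2 := hW' W' (isIsogenous_of_twoTorsionPair hlink)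
  have ha₁ := odd_a₁_integralModelInt_of_goodOrd_or_mult W hW
  have ha₁' := odd_a₁_integralModelInt_of_goodOrd_or_mult W' hred'
  have hCr : C.r = b := rfl
  have hRO : TwoTorsionRamifiedAtTwo C₀⁻¹.r ∧ TwoTorsionOdd W' C₀⁻¹.r :=
    (neither_iff_ramified_and_odd_of_twoIsogeny W W' C C₀⁻¹ ha₁ ha₁' hlink).mp (hCr ▸ ⟨hNR, hNO⟩)
  exact ⟨C, hNF, W', inferInstance, hmin, C₀⁻¹, hlink, hred', hasCM_iff_of_twoTorsionPair hlink,
    hasRationalTwoTorsionX_of_isTwoTorsionNF_smul W' C₀⁻¹, hRO.1, hRO.2⟩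

end Summit.BirchSwinnertonDyer.BirchSwinnertonDyer.Theorems.TwoAdicOffHabitat

end
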